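import Mathlib
import Summits.ValiantsHypothesis.ValiantsHypothesis.Theses.LiouvilleSarnak
import Summits.ValiantsHypothesis.ValiantsHypothesis.Theorems.LiouvilleSarnakLiouvilleCutRankBlockEntropy
import Summits.ValiantsHypothesis.ValiantsHypothesis.Theorems.LiouvilleSarnakLiouvilleCutRankBlockEntropyStructure
import Summits.ValiantsHypothesis.ValiantsHypothesis.Theorems.LiouvilleSarnakLiouvilleCutRankUpperEntropy

/-!
# Route LiouvilleSarnak — crux `LiouvilleCutRank` (stmt-ValiantsHypothesis-14775):
# word growth faster than every `2^{C √k}` already suffices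

`Theorems/LiouvilleSarnakLiouvilleCutRankUpperEntropy.lean` derives the crux from positive (upper)
sign-pattern ENTROPY of `λ` (`≥ 2^{η L}` patterns of length `L`, `η > 0` fixed).  The counting engine
behind it (`BlockEntropy.liouvilleCutRank_of_blockComplexity`) is in fact exponentially stronger: what a
bounded-rank cut caps is the number of patterns of length `B` by `2^{O(√B)}`, not by `2^{o(B)}`.  This file
records the resulting criterion in its natural SUB-EXPONENTIAL form, with natural-number exponents only:

* ★ `liouvilleCutRank_of_sqrtWordGrowth` — **if for every `C` there is a length `s` such that the
  Liouville sequence shows more than `2^{C s}` distinct sign patterns `(λ(m+1), …, λ(m+s²))` of length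
  `s²` (at positions `m < M`, any `M`), then `LiouvilleCutRank` holds.**  Equivalently: word growth
  `p_λ(k) ≠ O(2^{C √k})` for every `C` implies the crux.  (Round `s` up to `2^u ≤ 2s`, `B = 4^u ≥ s²`:
  `2^{(4C+3)s} < p(s²) ≤ p(B) ≤ B · a(B)²` forces `a(B) > 2^{C 2^u}` aligned block patterns.)
* `card_windows_le_of_rank_lt` — the unconditional contrapositive at one level, for windows at ARBITRARY
  positions: a balanced cut of level `n ≥ (t+1)(t+T)` with rank `< W` caps the number of sign patterns of
  `λ` of length `B = 4^t` among the windows `[m+1, m+B]`, `m < M` (`M / B + 2 ≤ 2^T`), by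
  `B · 2^{2 (2^W + W) 2^t} = 2^{O_W(√B)}`.

Placement (honest): the hypothesis of ★ is OPEN.  In print, the word complexity of `λ` is known to be
super-linear (Frantzikinakis–Host 2018) and at least almost quadratic (McNamara, *Sarnak's conjecture for
sequences of almost quadratic word growth*, ETDS 2021: `λ` does not correlate with sequences of
subquadratic word growth, in particular has `≫ k^{2-o(1)}` sign patterns of length `k`); Sarnak's (a
fortiori Chowla's) conjecture predicts exponential growth.  The crux `LiouvilleCutRank` therefore sits
between "`k²`" (proved) and "`2^{C√k}` for every `C`" (this file's sufficient condition).
`LiouvilleCutRank`, `DigitalBilinearLiouville`, `AlgebraicSarnak` stay OPEN; nothing here bears on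
`VP ≠ VNP`.  No definitions.
-/

-- the directory `ValiantsHypothesis/ValiantsHypothesis` repeats the summit name (tree layout)
set_option linter.dupNamespace false

namespace Summit.ValiantsHypothesis.ValiantsHypothesis.Theorems.LiouvilleSarnakLiouvilleCutRank.BlockEntropy

open Finset ArithmeticFunction

open Summit.ValiantsHypothesis.ValiantsHypothesis.Theses.LiouvilleSarnak (LiouvilleCutRank)

/-- Sign patterns of length `0` number at most one. [folklore] -/
theorem card_windows_zero_le (M : ℕ) :
    ((range M).image fun m : ℕ => fun j : Fin 0 => (liouville (m + j + 1) : ℤ)).card ≤ 1 := by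
  classical
  refine card_le_one.mpr fun a ha b hb => ?_
  funext j
  exact j.elim0

/-- ★ **Word growth faster than every `2^{C√k}` implies `LiouvilleCutRank`.**  If for every `C` there
are `s` and `M` such that the Liouville sequence has more than `2^{C s}` distinct sign patterns
`(λ(m+1), …, λ(m+s²))`, `m < M`, of length `s² = s * s`, then for every `W` eventually every balanced
digital cut matrix of `λ` has rank `≥ W`.  Proof: given `C`, use the hypothesis with `4C + 3`; with
`2^{u-1} ≤ s < 2^u` and `B = 4^u` one has `s² ≤ B ≤ 4 s²`, and
`2^{(4C+3)s} < p(s²) ≤ p(B) ≤ B · a(B)²` (`card_windows_mono`, `card_windows_le`) is incompatible with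
`a(B) ≤ 2^{C 2^u} ≤ 2^{2Cs}`; so `a(B) > 2^{C 2^u}` and `liouvilleCutRank_of_blockComplexity` applies.
[folklore] -/
theorem liouvilleCutRank_of_sqrtWordGrowth
    (h : ∀ C : ℕ, ∃ s M : ℕ, 2 ^ (C * s) <
      ((range M).image fun m : ℕ => fun j : Fin (s * s) => (liouville (m + j + 1) : ℤ)).card) :
    LiouvilleCutRank := by
  classical
  apply liouvilleCutRank_of_blockComplexity
  intro C
  obtain ⟨s, M, hsM⟩ := h (4 * C + 3)
  -- `s ≥ 1`: there is at most one pattern of length `0`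
  have hs : 1 ≤ s := by
    rcases Nat.eq_zero_or_pos s with h0 | h0
    · subst h0
      have h1 := card_windows_zero_le M
      simp only [Nat.mul_zero, pow_zero] at hsM
      exact absurd (hsM.trans_le (by simpa using h1)) (lt_irrefl _)
    · exact h0
  -- dyadic rounding: `2^{u-1} ≤ s < 2^u`, `u = log2 s + 1`
  set u : ℕ := Nat.log2 s + 1 with hudef
  have hlog := Nat.log2_self_le (Nat.ne_of_gt hs)   -- 2 ^ log2 s ≤ s
  have hlog' := Nat.lt_log2_self (n := s)           -- s < 2 ^ (log2 s + 1)
  have h2u : 2 ^ u ≤ 2 * s := by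
    have : 2 ^ u = 2 * 2 ^ Nat.log2 s := by rw [hudef, pow_succ]; ring
    omega
  have hs2u : s < 2 ^ u := hlog'
  have hulog : Nat.log2 s < s := by
    have := Nat.lt_two_pow_self (n := Nat.log2 s)
    omega
  have hus : u ≤ s := by rw [hudef]; omega
  set B : ℕ := 2 ^ (2 * u) with hBdef
  have hBpos : 0 < B := Nat.two_pow_pos _
  have hB : B = 2 ^ u * 2 ^ u := by rw [hBdef, ← pow_add]; ring_nf
  have hsB : s * s ≤ B := by
    rw [hB]; exact Nat.mul_le_mul hs2u.le hs2u.le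
  have hB4 : B ≤ 4 * (s * s) := by
    rw [hB]
    calc 2 ^ u * 2 ^ u ≤ (2 * s) * (2 * s) := Nat.mul_le_mul h2u h2u
      _ = 4 * (s * s) := by ring
  refine ⟨u, M / B + 2, ?_⟩
  set a : ℕ := ((range (M / B + 2)).image fun H : ℕ => fun j : Fin (2 ^ (2 * u)) =>
      (liouville (2 ^ (2 * u) * H + j + 1) : ℤ)).card with ha
  by_contra hle
  push Not at hle
  -- `2^{(4C+3)s} < p(s²) ≤ p(B) ≤ B a² ≤ 2^{2u} (2^{C 2^u})² ≤ 2^{2u + 4 C s}`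
  have hwin := card_windows_le B M hBpos
  rw [hBdef] at hwin
  have hmono := card_windows_mono hsB M
  rw [hBdef] at hmono
  have hCu : C * 2 ^ u ≤ 2 * C * s := by
    calc C * 2 ^ u ≤ C * (2 * s) := Nat.mul_le_mul_left C h2u
      _ = 2 * C * s := by ring
  have hchain : ((range M).image fun m : ℕ => fun j : Fin (s * s) =>
      (liouville (m + j + 1) : ℤ)).card ≤ 2 ^ (2 * u + 4 * C * s) := by
    calc _ ≤ _ := hmono
      _ ≤ 2 ^ (2 * u) * (a * a) := hwin
      _ ≤ 2 ^ (2 * u) * (2 ^ (C * 2 ^ u) * 2 ^ (C * 2 ^ u)) :=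
          Nat.mul_le_mul_left _ (Nat.mul_le_mul hle hle)
      _ ≤ 2 ^ (2 * u) * (2 ^ (2 * C * s) * 2 ^ (2 * C * s)) :=
          Nat.mul_le_mul_left _ (Nat.mul_le_mul (Nat.pow_le_pow_right Nat.two_pos hCu)
            (Nat.pow_le_pow_right Nat.two_pos hCu))
      _ = 2 ^ (2 * u + 4 * C * s) := by rw [← pow_add, ← pow_add]; ring_nf
  -- but `(4C+3) s ≥ 2u + 4 C s` since `u ≤ s`
  have hexp : 2 * u + 4 * C * s ≤ (4 * C + 3) * s := by nlinarith [hus]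
  have hfin : 2 ^ ((4 * C + 3) * s) < 2 ^ ((4 * C + 3) * s) :=
    calc 2 ^ ((4 * C + 3) * s) < _ := hsM
      _ ≤ 2 ^ (2 * u + 4 * C * s) := hchain
      _ ≤ 2 ^ ((4 * C + 3) * s) := Nat.pow_le_pow_right Nat.two_pos hexp
  exact lt_irrefl _ hfin

/-- **The contrapositive at one level, for windows at arbitrary positions.**  If a balanced cut `π`
of `2n` positions has cut-matrix rank `< W` and `(t+1)(t+T) ≤ n`, then among the windows
`(λ(m+1), …, λ(m+B))`, `m < M`, of length `B = 4^t`, with `M / B + 2 ≤ 2^T`, at most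
`B · 2^{2 (2^W + W) 2^t}` distinct sign patterns occur (`= 2^{O_W(√B)}` of the `2^B` conceivable ones):
`p(B; M) ≤ B · a(B)²` (`card_windows_le`) and `a(B) ≤ 2^{(2^W+W) 2^t}`
(`card_blockPatterns_le_of_rank_lt`). [folklore] -/
theorem card_windows_le_of_rank_lt (W t T n M : ℕ) (hn : (t + 1) * (t + T) ≤ n)
    (hM : M / 2 ^ (2 * t) + 2 ≤ 2 ^ T)
    (π : Fin n ⊕ Fin n ≃ Fin (2 * n))
    (hrank : (Matrix.of fun r c : Fin n → Bool =>
      (((liouville (Nat.ofBits (fun j : Fin (2 * n) => Sum.elim r c (π.symm j)) + 1) : ℤ) :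
        ℂ))).rank < W) :
    ((range M).image fun m : ℕ => fun j : Fin (2 ^ (2 * t)) =>
        (liouville (m + j + 1) : ℤ)).card ≤
      2 ^ (2 * t) * 2 ^ (2 * ((2 ^ W + W) * 2 ^ t)) := by
  classical
  set B : ℕ := 2 ^ (2 * t) with hBdef
  have hBpos : 0 < B := Nat.two_pow_pos _
  have hwin := card_windows_le B M hBpos
  rw [hBdef] at hwin
  have hblocks := card_blockPatterns_le_of_rank_lt W t T n hn π hrank
  -- the aligned blocks `H < M / B + 2` are among the blocks `H < 2^T`
  have hsub : ((range (M / 2 ^ (2 * t) + 2)).image fun H : ℕ => fun j : Fin (2 ^ (2 * t)) =>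
        (liouville (2 ^ (2 * t) * H + j + 1) : ℤ)) ⊆
      ((range (2 ^ T)).image fun H : ℕ => fun i : Fin (2 ^ (2 * t)) =>
        (liouville (2 ^ (2 * t) * H + i + 1) : ℤ)) :=
    image_subset_image (range_subset_range.mpr hM)
  have ha : ((range (M / 2 ^ (2 * t) + 2)).image fun H : ℕ => fun j : Fin (2 ^ (2 * t)) =>
        (liouville (2 ^ (2 * t) * H + j + 1) : ℤ)).card ≤ 2 ^ ((2 ^ W + W) * 2 ^ t) :=
    (card_le_card hsub).trans hblocks
  calc _ ≤ _ := hwin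
    _ ≤ 2 ^ (2 * t) * (2 ^ ((2 ^ W + W) * 2 ^ t) * 2 ^ ((2 ^ W + W) * 2 ^ t)) :=
        Nat.mul_le_mul_left _ (Nat.mul_le_mul ha ha)
    _ = 2 ^ (2 * t) * 2 ^ (2 * ((2 ^ W + W) * 2 ^ t)) := by rw [← pow_add]; ring_nf

end Summit.ValiantsHypothesis.ValiantsHypothesis.Theorems.LiouvilleSarnakLiouvilleCutRank.BlockEntropy
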